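import Literature.Geometry.Riemannian.WassersteinW1LimitPoints
import Literature.Geometry.Riemannian.MetricFlowConcentration
import Mathlib.MeasureTheory.Measure.HasOuterApproxClosed
import Mathlib.Topology.MetricSpace.ThickenedIndicator
import Mathlib.MeasureTheory.Measure.GiryMonad
import Mathlib.MeasureTheory.Measure.Portmanteau
import Mathlib.MeasureTheory.Measure.FiniteMeasureProd
import HarnessLib

/-!
# Measure-theoretic toolkit for the limit metric flow: Lipschitz test functions determine finite
# measures and kernels; the variance is lower semicontinuous under `W₁`-convergence
# (Bamler 2023, §5.4, proof of Lemma 5.20; §7.3, Lemma 7.? (arXiv v1 Lemma 166))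

R. Bamler, *Compactness theory of the space of super Ricci flows*, Invent. Math. 233 (2023). In
§5.4, proof of Lemma 5.20 (arXiv v1 Lemma 121, Claim 123), the limit conjugate heat kernels
`ν^∞_{x^∞;s}` are obtained as `W₁`-limits and the axioms of a metric flow are verified against
bounded Lipschitz test functions only: *"For Property (7) fix `t₁ < t₂ < t₃` …, `x^∞ ∈ X^∞_{t₃}`.
It suffices to show that for every bounded Lipschitz function `f : X^∞_{t₃} → ℝ`,
`∫_{X^∞_{t₁}} f dν^∞_{x^∞;t₁} = ∫_{X^∞_{t₂}} ∫_{X^∞_{t₁}} f dν^∞_{y;t₁} dν^∞_{x^∞;t₂}(y)`"*, the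
inner integrals `y ↦ ∫ f dν^∞_{y;t₁}` being Lipschitz in `y` (*"the functions `hⁱ` … are uniformly
Lipschitz"*). In §7.3, proof of Lemma 7.? (arXiv v1 Lemma 166: *"`𝔽^J_I(H, V, b, r) ⊂ 𝔽^J_I` is
closed"*), the `H`-concentration of a limit flow is read off from `W₁`-convergence of the kernels:
*"`(φⁱ_s)_* νⁱ_{xⁱ;s} → (φ^∞_s)_* ν^∞_{x^∞;s}`, `(φⁱ_s)_* νⁱ_{yⁱ;s} → (φ^∞_s)_* ν^∞_{y^∞;s}` in
`W₁` … It follows that `Var(ν^∞_{x^∞;s}, ν^∞_{y^∞;s}) ≤ limsup_{i → ∞} Var((φⁱ_s)_* νⁱ_{xⁱ;s},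
(φⁱ_s)_* νⁱ_{yⁱ;s}) ≤ (d^∞_t(x^∞, y^∞))² + H(t − s)`"*, and likewise
*"`Var(μ^∞_t) ≤ liminf_{i → ∞} Var(μⁱ_t) ≤ V + H(t_∞ − t)`"*.

This file supplies the three measure-theoretic facts behind these steps, for finite Borel
measures on a metric space `X` (the tree's `variance`, `wassersteinW1` from
`MetricFlowConcentration.lean`):

* `ext_of_forall_integral_lipschitz_eq` — **two finite Borel measures with the same integrals of
  all Lipschitz `[0, 1]`-valued functions are equal**: the Lipschitz thickened indicators
  `χ^{1/(n+1)}_F` (`thickenedIndicator`) of a closed set `F` decrease boundedly to `𝟙_F`, so the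
  measures agree on the π-system of closed sets, which generates the Borel σ-algebra;
* `measurable_measure_of_forall_lipschitz` — **a family `κ : Y → 𝓜(X)` of finite measures is
  measurable (Giry σ-algebra) as soon as `y ↦ ∫ u dκ_y` is measurable for every Lipschitz
  `[0, 1]`-valued `u`**: `y ↦ κ_y(F)` is then a pointwise limit of measurable functions for closed
  `F`, and closed sets form a generating π-system (`Measurable.measure_of_isPiSystem`);
* `variance_le_liminf_of_tendsto_of_tendsto_wassersteinW1` — **`Var(α_∞, β_∞) ≤
  liminf Var(αₙ, βₙ)` when `αₙ → α_∞`, `βₙ → β_∞` in `W₁`** (probability measures on a separable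
  metric space; two sequences, as needed for `Var(ν_{x;s}, ν_{y;s})`): `W₁`-convergence gives weak
  convergence (`tendsto_probabilityMeasure_mk_of_tendsto_wassersteinW1`), the products `αₙ ⊗ βₙ`
  converge weakly (`ProbabilityMeasure.continuous_prod`), and `Var(α, β) = ∫ d² d(α ⊗ β)` is a
  weakly lower semicontinuous functional of `α ⊗ β` since `d²` is continuous and nonnegative
  (portmanteau for open sets and the layer-cake formula,
  `lintegral_le_liminf_lintegral_of_forall_isOpen_measure_le_liminf_measure`). The diagonal case
  `Var(μ_∞) ≤ liminf Var(μᵢ)` (§2.5, Lemma (a)) is `variance_le_liminf_of_tendsto_wassersteinW1`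
  in `VarianceLowerSemicontinuous.lean`.

Everything is proved; no definitions, no named facts.

## References

* R. H. Bamler, *Compactness theory of the space of super Ricci flows*, Invent. Math. 233 (2023),
  1121–1277 (arXiv:2008.09298), §5.4, proof of Lemma 5.20 (arXiv v1 Lemma 121, Claim 123); §7.3,
  Lemma 7.? (arXiv v1 Lemma 166) and its proof. [Bamler2023]
-/

noncomputable section

open Set MeasureTheory Filter TopologicalSpace Function
open scoped Topology ENNReal NNReal

namespace Literature.Geometry.Riemannian

universe u

/-! ### Lipschitz thickened indicators of closed sets -/

section ThickenedIndicator

variable {X : Type*} [MetricSpace X]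

/-- The radii `δₙ = 1/(n+1)` are positive. [folklore] -/
private theorem one_div_succ_pos (n : ℕ) : (0 : ℝ) < 1 / ((n : ℝ) + 1) := Nat.one_div_pos_of_nat

/-- The real-valued thickened indicator `χ^δ_F` of a set is Lipschitz. [folklore] -/
private theorem lipschitzWith_coe_thickenedIndicator {δ : ℝ} (hδ : 0 < δ) (F : Set X) :
    LipschitzWith (1 * δ.toNNReal⁻¹) fun x ↦ ((thickenedIndicator hδ F x : ℝ≥0) : ℝ) :=
  NNReal.isometry_coe.lipschitz.comp (lipschitzWith_thickenedIndicator hδ F)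

/-- The real-valued thickened indicator takes values in `[0, 1]`. [folklore] -/
private theorem coe_thickenedIndicator_mem_Icc {δ : ℝ} (hδ : 0 < δ) (F : Set X) (x : X) :
    ((thickenedIndicator hδ F x : ℝ≥0) : ℝ) ∈ Icc (0 : ℝ) 1 :=
  ⟨NNReal.coe_nonneg _, by exact_mod_cast thickenedIndicator_le_one hδ F x⟩

end ThickenedIndicator

/-! ### Finite measures are determined by Lipschitz test functions -/

section Ext

variable {X : Type*} [MetricSpace X] [MeasurableSpace X] [BorelSpace X]

/-- Two finite Borel measures with the same integrals of Lipschitz `[0, 1]`-valued functions give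
the same mass to every closed set `F`: `μ(F) = limₙ ∫ χ^{1/(n+1)}_F dμ` (dominated convergence,
`tendsto_integral_thickenedIndicator_of_isClosed`). [folklore] -/
private theorem measure_isClosed_eq_of_forall_integral_lipschitz_eq {μ ν : Measure X}
    [IsFiniteMeasure μ] [IsFiniteMeasure ν]
    (h : ∀ (u : X → ℝ) (K : ℝ≥0), LipschitzWith K u → (∀ x, u x ∈ Icc (0 : ℝ) 1) →
      ∫ x, u x ∂μ = ∫ x, u x ∂ν) {F : Set X} (hF : IsClosed F) :
    μ F = ν F := by
  have hμ := tendsto_integral_thickenedIndicator_of_isClosed μ hF one_div_succ_pos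
    tendsto_one_div_add_atTop_nhds_zero_nat
  have hν := tendsto_integral_thickenedIndicator_of_isClosed ν hF one_div_succ_pos
    tendsto_one_div_add_atTop_nhds_zero_nat
  have heq : ∀ n : ℕ, ∫ x, ((thickenedIndicator (one_div_succ_pos n) F x : ℝ≥0) : ℝ) ∂μ =
      ∫ x, ((thickenedIndicator (one_div_succ_pos n) F x : ℝ≥0) : ℝ) ∂ν := fun n ↦
    h _ _ (lipschitzWith_coe_thickenedIndicator (one_div_succ_pos n) F)
      (coe_thickenedIndicator_mem_Icc (one_div_succ_pos n) F)
  simp only [heq] at hμ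
  have hreal : μ.real F = ν.real F := tendsto_nhds_unique hμ hν
  rw [Measure.real_def, Measure.real_def] at hreal
  exact (ENNReal.toReal_eq_toReal_iff' (measure_ne_top μ F) (measure_ne_top ν F)).1 hreal

end Ext

/-- **Finite Borel measures on a metric space are determined by the integrals of Lipschitz
`[0, 1]`-valued functions**: if `∫ u dμ = ∫ u dν` for every Lipschitz `u : X → [0, 1]`, then
`μ = ν` (Bamler 2023, §5.4, proof of Lemma 5.20, Claim 123: *"It suffices to show that for every
bounded Lipschitz function `f` …"*). The measures agree on closed sets
(`measure_isClosed_eq_of_forall_integral_lipschitz_eq`), a π-system generating the Borel σ-algebra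
(`borel_eq_generateFrom_isClosed`, `ext_of_generate_finite`). [folklore] -/
theorem ext_of_forall_integral_lipschitz_eq {X : Type*} [MetricSpace X] [MeasurableSpace X]
    [BorelSpace X] {μ ν : Measure X} [IsFiniteMeasure μ] [IsFiniteMeasure ν]
    (h : ∀ (u : X → ℝ) (K : ℝ≥0), LipschitzWith K u → (∀ x, u x ∈ Icc (0 : ℝ) 1) →
      ∫ x, u x ∂μ = ∫ x, u x ∂ν) :
    μ = ν := by
  refine ext_of_generate_finite _ ?_ isPiSystem_isClosed
    (fun F hF ↦ measure_isClosed_eq_of_forall_integral_lipschitz_eq h hF)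
    (measure_isClosed_eq_of_forall_integral_lipschitz_eq h isClosed_univ)
  rw [BorelSpace.measurable_eq (α := X), borel_eq_generateFrom_isClosed]

/-! ### Measurability of a family of measures from Lipschitz test functions -/

/-- **A family of finite measures that is measurable against Lipschitz `[0, 1]`-valued test
functions is measurable** for the Giry σ-algebra on `Measure X` (used for the limit kernels
`x ↦ ν^∞_{x;s}` of Bamler 2023, §5.4, proof of Lemma 5.20, which are `W₁`-Lipschitz in `x`, so
that `x ↦ ∫ u dν^∞_{x;s}` is Lipschitz for Lipschitz `u`: *"the functions `hⁱ` … are uniformly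
Lipschitz"*). For a closed set `F`, `y ↦ κ_y(F) = limₙ ∫ χ^{1/(n+1)}_F dκ_y` is a pointwise limit of
measurable functions (`tendsto_lintegral_thickenedIndicator_of_isClosed`,
`ENNReal.measurable_of_tendsto`); closed sets form a π-system generating the Borel σ-algebra, so
`Measurable.measure_of_isPiSystem` concludes. [folklore] -/
theorem measurable_measure_of_forall_lipschitz {X Y : Type*} [MetricSpace X] [MeasurableSpace X]
    [BorelSpace X] [MeasurableSpace Y] (κ : Y → Measure X) [∀ y, IsFiniteMeasure (κ y)]
    (h : ∀ (u : X → ℝ) (K : ℝ≥0), LipschitzWith K u → (∀ x, u x ∈ Icc (0 : ℝ) 1) →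
      Measurable fun y ↦ ∫ x, u x ∂κ y) :
    Measurable κ := by
  -- closed sets: `κ y F = limₙ ∫ χₙ dκ y`, a pointwise limit of measurable functions of `y`
  have hclosed : ∀ F : Set X, IsClosed F → Measurable fun y ↦ κ y F := by
    intro F hF
    refine ENNReal.measurable_of_tendsto
      (f := fun n y ↦ ENNReal.ofReal
        (∫ x, ((thickenedIndicator (one_div_succ_pos n) F x : ℝ≥0) : ℝ) ∂κ y))
      (fun n ↦ (h _ _ (lipschitzWith_coe_thickenedIndicator (one_div_succ_pos n) F)
        (coe_thickenedIndicator_mem_Icc (one_div_succ_pos n) F)).ennreal_ofReal) ?_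
    rw [tendsto_pi_nhds]
    intro y
    have hy := tendsto_lintegral_thickenedIndicator_of_isClosed (κ y) hF one_div_succ_pos
      tendsto_one_div_add_atTop_nhds_zero_nat
    refine hy.congr fun n ↦ ?_
    rw [lintegral_coe_eq_integral]
    exact integrable_thickenedIndicator F (one_div_succ_pos n)
  refine Measurable.measure_of_isPiSystem ?_ isPiSystem_isClosed (fun F hF ↦ hclosed F hF)
    (hclosed univ isClosed_univ)
  rw [BorelSpace.measurable_eq (α := X), borel_eq_generateFrom_isClosed]

/-! ### Lower semicontinuity of the variance under `W₁`-convergence -/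

section Variance

variable {X : Type*} [MetricSpace X] [MeasurableSpace X] [BorelSpace X]
  [SecondCountableTopology X]

/-- The variance as an integral over the product measure: `Var(μ, ν) = ∫ d² d(μ ⊗ ν)` (Tonelli).
[cite: Bamler2023, §2.2, Definition (Variance)] -/
theorem lintegral_prod_edist_sq_eq_variance (μ ν : Measure X) [SFinite ν] :
    ∫⁻ p, edist p.1 p.2 ^ 2 ∂(μ.prod ν) = variance μ ν := by
  rw [variance_def, lintegral_prod _ (measurable_edist.pow_const 2).aemeasurable]

end Variance

/-- **Lower semicontinuity of the variance under `W₁`-convergence** (Bamler 2023, §7.3, proof of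
Lemma 7.? (arXiv v1 Lemma 166): *"It follows that `Var(ν^∞_{x^∞;s}, ν^∞_{y^∞;s}) ≤
limsup_{i→∞} Var((φⁱ_s)_* νⁱ_{xⁱ;s}, (φⁱ_s)_* νⁱ_{yⁱ;s})`"* from the `W₁`-convergence of the two
sequences of kernels; likewise *"`Var(μ^∞_t) ≤ liminf_{i→∞} Var(μⁱ_t)`"*): if `αₙ → α_∞` and
`βₙ → β_∞` in `d_{W₁}` (probability measures on a separable metric space), then
`Var(α_∞, β_∞) ≤ liminfₙ Var(αₙ, βₙ)`. Proof: `W₁`-convergence gives weak convergence, hence weak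
convergence of the products `αₙ ⊗ βₙ → α_∞ ⊗ β_∞` (`ProbabilityMeasure.continuous_prod`), and
`ρ ↦ ∫ d² dρ` is weakly lower semicontinuous for the continuous nonnegative integrand `d²`
(portmanteau, `lintegral_le_liminf_lintegral_of_forall_isOpen_measure_le_liminf_measure`). The
diagonal case (one sequence, `Var(μ) = Var(μ, μ)`; §2.5, Lemma (a)) is
`variance_le_liminf_of_tendsto_wassersteinW1` (`VarianceLowerSemicontinuous.lean`).
[cite: Bamler2023, §5.4, proof of Lemma 5.20; §7.3, Lemma 7.? (arXiv v1 Lemma 166), proof] -/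
theorem variance_le_liminf_of_tendsto_of_tendsto_wassersteinW1 {X : Type*} [MetricSpace X]
    [MeasurableSpace X] [BorelSpace X] [SecondCountableTopology X]
    {α β : ℕ → Measure X} {αinf βinf : Measure X} [∀ n, IsProbabilityMeasure (α n)]
    [∀ n, IsProbabilityMeasure (β n)] [IsProbabilityMeasure αinf] [IsProbabilityMeasure βinf]
    (hα : Tendsto (fun n ↦ wassersteinW1 (α n) αinf) atTop (𝓝 0))
    (hβ : Tendsto (fun n ↦ wassersteinW1 (β n) βinf) atTop (𝓝 0)) :
    variance αinf βinf ≤ liminf (fun n ↦ variance (α n) (β n)) atTop := by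
  have hα' := tendsto_probabilityMeasure_mk_of_tendsto_wassersteinW1 hα
  have hβ' := tendsto_probabilityMeasure_mk_of_tendsto_wassersteinW1 hβ
  -- weak convergence of the product measures
  have hprod : Tendsto
      (fun n ↦ ProbabilityMeasure.prod (⟨α n, inferInstance⟩ : ProbabilityMeasure X)
        (⟨β n, inferInstance⟩ : ProbabilityMeasure X)) atTop
      (𝓝 (ProbabilityMeasure.prod (⟨αinf, inferInstance⟩ : ProbabilityMeasure X)
        (⟨βinf, inferInstance⟩ : ProbabilityMeasure X))) :=
    (ProbabilityMeasure.continuous_prod.tendsto _).comp (hα'.prodMk_nhds hβ')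
  -- portmanteau: open sets of the product
  have hopen : ∀ G : Set (X × X), IsOpen G →
      αinf.prod βinf G ≤ liminf (fun n ↦ (α n).prod (β n) G) atTop := fun G hG ↦
    ProbabilityMeasure.le_liminf_measure_open_of_tendsto hprod hG
  -- lower semicontinuity of `ρ ↦ ∫ d² dρ`
  have hlsc := lintegral_le_liminf_lintegral_of_forall_isOpen_measure_le_liminf_measure
    (μ := αinf.prod βinf) (μs := fun n ↦ (α n).prod (β n))
    (f := fun p : X × X ↦ dist p.1 p.2 ^ 2) (by fun_prop) (fun p ↦ by positivity) hopen
  have hsq : ∀ p : X × X, ENNReal.ofReal (dist p.1 p.2 ^ 2) = edist p.1 p.2 ^ 2 := fun p ↦ by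
    rw [edist_dist, ENNReal.ofReal_pow dist_nonneg]
  simp only [hsq, lintegral_prod_edist_sq_eq_variance] at hlsc
  exact hlsc

end Literature.Geometry.Riemannian

end
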